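import Literature.AlgebraicGeometry.Morphisms.SectionsFpqcDescentPieces
import HarnessLib

/-!
# Sections of a quasi-coherent module form an fpqc sheaf, III b: quasi-compact (not necessarily affine) covers

Topic `Literature/AlgebraicGeometry/Morphisms`, namespace `Literature.AlgebraicGeometry.Morphisms`.  THEOREMS ONLY; no
definition, no named fact, no instance, no notation, no `sorry`.

[SGA1] Exp. VIII Thm. 1.1, Cor. 1.2 / [StacksProject, Tag 023M] / [GortzWedhorn2020] Prop. 14.66 for `g : Z → X` flat, surjective
and QUASI-COMPACT (an fpqc morphism; ★ `Morphisms/SectionsFpqcDescent` is the case `g` affine): for a kernel pair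
`p₁, p₂ : Z₂ ⇉ Z` (ANY cartesian square `IsPullback p₁ p₂ g g`), a quasi-coherent `𝒪_X`-module `M` and ANY open `V ⊆ X`,

* **`unitSection_injective_of_quasiCompact`** — `η : Γ(V, M) → Γ(g⁻¹V, g^*M)` is injective;
* **`existsUnique_unitSection_eq_of_quasiCompact`** — a section `s ∈ Γ(g⁻¹V, g^*M)` whose two cofaces
  `p₁^*s|_{U₂} = p₂^*s|_{U₂}` (`U₂ = p₁⁻¹g⁻¹V ∩ p₂⁻¹g⁻¹V`, the second read through `pullbackCongr`) agree is `η(m)` for a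
  unique `m ∈ Γ(V, M)`;
* **`mem_range_unitSection_iff_of_quasiCompact`** — the range form (exactness of
  `0 → Γ(V, M) → Γ(g⁻¹V, g^*M) ⇉ Γ(U₂, (p₁ ≫ g)^*M)`).

Proof: over an affine `V`, `g⁻¹V` is a FINITE union of affine opens `U_i` (`exists_finite_affineOpens_cover_preimage`);
`Γ(V) → ∏ Γ(U_i)` is faithfully flat (★ `faithfullyFlat_pi_appLE`), `∏ Γ(U_i, g^*M)` and `∏_{ij} Γ(p₁⁻¹U_i ∩ p₂⁻¹U_j, (p₁ ≫ g)^*M)`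
are the base changes of `Γ(V, M)` (★ `isBaseChange_unitSectionLE` chart by chart, ★ `isBaseChange_pi_algebra`) and
`∏_{ij} Γ(p₁⁻¹U_i ∩ p₂⁻¹U_j) = (∏ Γ(U_i)) ⊗ (∏ Γ(U_j))` (★ `bijective_lift_kernelPair_of_le`, ★ `bijective_lift_pi_pi`); Amitsur's
degree-zero exactness in base-change-data form (★ `RingTheory/Flat/AmitsurDescentData`) gives the chart statements §1
(`unitSection_injective_of_affine_of_iSup`, `existsUnique_unitSection_eq_of_affine_of_iSup`), and the Zariski gluing over the
affine opens of `X` (§2) is ★ `Morphisms/SectionsFpqcDescent` verbatim.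
-- TODO(general form): an fpqc covering FAMILY `{Z_α → X}` (reduce to the disjoint union).

HC_CM is proved only modulo the 7 printed citations until rung 0 closes; nothing here is about HC.

## References
* [SGA1] A. Grothendieck, *SGA 1*, Exp. VIII §1, Thm. 1.1, Cor. 1.2.
* [StacksProject] The Stacks Project, Tag 023M (Descent, Lemma 35.3.6).
* [GortzWedhorn2020] U. Görtz, T. Wedhorn, *Algebraic Geometry I*, 2nd ed. (2020), Prop. 14.66.
-/

noncomputable section

-- `TopCat.Presheaf`/`Scheme.Modules` are not reducible (as in Mathlib's `AlgebraicGeometry/Modules`).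
set_option backward.isDefEq.respectTransparency false

universe u

open CategoryTheory CategoryTheory.Limits AlgebraicGeometry TopologicalSpace Opposite TensorProduct

namespace Literature.AlgebraicGeometry.Morphisms

open Literature.AlgebraicGeometry.Modules Literature.RingTheory.Flat

variable {X Z Z₂ : Scheme.{u}} (g : Z ⟶ X) (p₁ p₂ : Z₂ ⟶ Z) (M : X.Modules)

/-! ### §1 The chart statements over an affine `V` with `g⁻¹V` a finite union of affine opens -/

section Chart

variable {V : X.Opens}

/-- **`η : Γ(V, M) → Γ(g⁻¹V, g^*M)` is injective** for `g` flat and surjective, `V` affine, `g⁻¹V` covered by finitely many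
affine opens `U_i` and `M` quasi-coherent: `m ↦ (η(m)|_{U_i})_i` is the base change of `Γ(V, M)` along the faithfully flat
`Γ(V) → ∏ Γ(U_i)` (★ `isBaseChange_unitSectionLE` per piece, ★ `isBaseChange_pi_algebra`, `faithfullyFlat_pi_appLE`), hence
injective (★ `injective_of_isBaseChange`). [cite: StacksProject, Tag 023M] [cite: GortzWedhorn2020, Prop. 14.66] -/
theorem unitSection_injective_of_affine_of_iSup [Flat g] [Surjective g] [M.IsQuasicoherent] (hV : IsAffineOpen V)
    {ι : Type u} [Finite ι] (U : ι → Z.Opens) (hUV : ∀ i, U i ≤ g ⁻¹ᵁ V) (hUaff : ∀ i, IsAffineOpen (U i))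
    (hcov : g ⁻¹ᵁ V ≤ ⨆ i, U i) : Function.Injective (unitSection g M V) := by
  have hM : IsAffineLocalizing M := IsAffineLocalizing.of_isQuasicoherent M
  letI instAlg : ∀ i, Algebra Γ(X, V) Γ(Z, U i) := fun i => (g.appLE V (U i) (hUV i)).hom.toAlgebra
  letI instMod : ∀ i, Module Γ(X, V) Γ((Scheme.Modules.pullback g).obj M, U i) :=
    fun i => Module.compHom _ (g.appLE V (U i) (hUV i)).hom
  haveI instIST : ∀ i, IsScalarTower Γ(X, V) Γ(Z, U i) Γ((Scheme.Modules.pullback g).obj M, U i) :=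
    fun i => ⟨fun a b x => mul_smul ((g.appLE V (U i) (hUV i)).hom a) b x⟩
  have hj : ∀ i, IsBaseChange Γ(Z, U i) (unitSectionLEₗ g M (hUV i)) :=
    fun i => isBaseChange_unitSectionLE g M (hUV i) hV (hUaff i) hM
  haveI : Module.FaithfullyFlat Γ(X, V) (Π i, Γ(Z, U i)) := faithfullyFlat_pi_appLE g hV U hUV hUaff hcov
  have hJ := isBaseChange_pi_algebra (R := Γ(X, V)) (fun i => Γ(Z, U i))
    (fun i => Γ((Scheme.Modules.pullback g).obj M, U i)) (fun i => unitSectionLEₗ g M (hUV i)) hj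
  intro m m' h
  refine injective_of_isBaseChange _ hJ ?_
  funext i
  simp only [LinearMap.pi_apply, unitSectionLEₗ_apply, unitSectionLE]
  rw [h]

/-- **Descent of sections on an affine chart with a finite affine cover of `g⁻¹V`.**  Let `g : Z → X` be flat and surjective,
`p₁, p₂ : Z₂ ⇉ Z` a kernel pair (`IsPullback p₁ p₂ g g`), `M` quasi-coherent, `V ⊆ X` affine and `U_i ⊆ g⁻¹V` finitely many
affine opens covering `g⁻¹V`.  A section `s ∈ Γ(g⁻¹V, g^*M)` whose two cofaces on `U₂(V) = p₁⁻¹g⁻¹V ∩ p₂⁻¹g⁻¹V` agree is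
`η(m)` for a UNIQUE `m ∈ Γ(V, M)`: Amitsur's degree-zero exactness (★ `existsUnique_of_isBaseChange`) for the faithfully flat
`Γ(V) → ∏ Γ(U_i)` (`faithfullyFlat_pi_appLE`), its kernel pair `∏_{ij} Γ(p₁⁻¹U_i ∩ p₂⁻¹U_j) = (∏ Γ(U_i)) ⊗ (∏ Γ(U_j))`
(`bijective_lift_kernelPair_of_le`, ★ `bijective_lift_pi_pi`) and the base changes `∏ Γ(U_i, g^*M)`,
`∏_{ij} Γ(p₁⁻¹U_i ∩ p₂⁻¹U_j, (p₁ ≫ g)^*M)` of `Γ(V, M)` (★ `isBaseChange_unitSectionLE`, ★ `isBaseChange_pi_algebra`); the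
solution with `η(m)|_{U_i} = s|_{U_i}` for all `i` has `η(m) = s` by locality in `g^*M`.
[cite: SGA1, Exp. VIII Thm. 1.1 and Cor. 1.2] [cite: StacksProject, Tag 023M] [cite: GortzWedhorn2020, Prop. 14.66] -/
theorem existsUnique_unitSection_eq_of_affine_of_iSup [Flat g] [Surjective g] [M.IsQuasicoherent] (H₂ : IsPullback p₁ p₂ g g)
    (hV : IsAffineOpen V) {ι : Type u} [Finite ι] (U : ι → Z.Opens) (hUV : ∀ i, U i ≤ g ⁻¹ᵁ V)
    (hUaff : ∀ i, IsAffineOpen (U i)) (hcov : g ⁻¹ᵁ V ≤ ⨆ i, U i)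
    (s : Γ((Scheme.Modules.pullback g).obj M, g ⁻¹ᵁ V))
    (hs : ((Scheme.Modules.pullback (p₁ ≫ g)).obj M).presheaf.map
        (homOfLE (inf_le_left : p₁ ⁻¹ᵁ (g ⁻¹ᵁ V) ⊓ p₂ ⁻¹ᵁ (g ⁻¹ᵁ V) ≤ p₁ ⁻¹ᵁ (g ⁻¹ᵁ V))).op
        (((Scheme.Modules.pullbackComp p₁ g).hom.app M).app (p₁ ⁻¹ᵁ (g ⁻¹ᵁ V))
          (unitSection p₁ ((Scheme.Modules.pullback g).obj M) (g ⁻¹ᵁ V) s)) =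
      ((Scheme.Modules.pullback (p₁ ≫ g)).obj M).presheaf.map
        (homOfLE (inf_le_right : p₁ ⁻¹ᵁ (g ⁻¹ᵁ V) ⊓ p₂ ⁻¹ᵁ (g ⁻¹ᵁ V) ≤ p₂ ⁻¹ᵁ (g ⁻¹ᵁ V))).op
        (((Scheme.Modules.pullbackCongr H₂.w.symm).hom.app M).app (p₂ ⁻¹ᵁ (g ⁻¹ᵁ V))
          (((Scheme.Modules.pullbackComp p₂ g).hom.app M).app (p₂ ⁻¹ᵁ (g ⁻¹ᵁ V))
            (unitSection p₂ ((Scheme.Modules.pullback g).obj M) (g ⁻¹ᵁ V) s)))) :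
    ∃! m : Γ(M, V), unitSection g M V m = s := by
  have hM : IsAffineLocalizing M := IsAffineLocalizing.of_isQuasicoherent M
  -- the pieces of the kernel pair and their structure maps to `Γ(V)`
  have h₂V : ∀ i j, p₁ ⁻¹ᵁ U i ⊓ p₂ ⁻¹ᵁ U j ≤ (p₁ ≫ g) ⁻¹ᵁ V :=
    fun i j => inf_le_left.trans (p₁.preimage_mono (hUV i))
  have hU₂aff : ∀ i j, IsAffineOpen (p₁ ⁻¹ᵁ U i ⊓ p₂ ⁻¹ᵁ U j) :=
    fun i j => isAffineOpen_of_isPullback_of_eq_inf H₂ hV (hUaff j) (hUaff i) (hUV j) (hUV i) rfl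
  -- rings `R = Γ(V) → S = ∏ Γ(U_i)`, `R → S₂ = ∏_{ij} Γ(p₁⁻¹U_i ∩ p₂⁻¹U_j)` and the modules of sections
  letI instAlg : ∀ i, Algebra Γ(X, V) Γ(Z, U i) := fun i => (g.appLE V (U i) (hUV i)).hom.toAlgebra
  letI instMod : ∀ i, Module Γ(X, V) Γ((Scheme.Modules.pullback g).obj M, U i) :=
    fun i => Module.compHom _ (g.appLE V (U i) (hUV i)).hom
  haveI instIST : ∀ i, IsScalarTower Γ(X, V) Γ(Z, U i) Γ((Scheme.Modules.pullback g).obj M, U i) :=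
    fun i => ⟨fun a b x => mul_smul ((g.appLE V (U i) (hUV i)).hom a) b x⟩
  letI instAlg₂ : ∀ i j, Algebra Γ(X, V) Γ(Z₂, p₁ ⁻¹ᵁ U i ⊓ p₂ ⁻¹ᵁ U j) :=
    fun i j => ((p₁ ≫ g).appLE V (p₁ ⁻¹ᵁ U i ⊓ p₂ ⁻¹ᵁ U j) (h₂V i j)).hom.toAlgebra
  letI instMod₂ : ∀ i j, Module Γ(X, V) Γ((Scheme.Modules.pullback (p₁ ≫ g)).obj M, p₁ ⁻¹ᵁ U i ⊓ p₂ ⁻¹ᵁ U j) :=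
    fun i j => Module.compHom _ ((p₁ ≫ g).appLE V (p₁ ⁻¹ᵁ U i ⊓ p₂ ⁻¹ᵁ U j) (h₂V i j)).hom
  haveI instIST₂ : ∀ i j, IsScalarTower Γ(X, V) Γ(Z₂, p₁ ⁻¹ᵁ U i ⊓ p₂ ⁻¹ᵁ U j)
      Γ((Scheme.Modules.pullback (p₁ ≫ g)).obj M, p₁ ⁻¹ᵁ U i ⊓ p₂ ⁻¹ᵁ U j) :=
    fun i j => ⟨fun a b x => mul_smul (((p₁ ≫ g).appLE V (p₁ ⁻¹ᵁ U i ⊓ p₂ ⁻¹ᵁ U j) (h₂V i j)).hom a) b x⟩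
  -- base changes, faithful flatness
  have hj : ∀ i, IsBaseChange Γ(Z, U i) (unitSectionLEₗ g M (hUV i)) :=
    fun i => isBaseChange_unitSectionLE g M (hUV i) hV (hUaff i) hM
  have hj₂ : ∀ i j, IsBaseChange Γ(Z₂, p₁ ⁻¹ᵁ U i ⊓ p₂ ⁻¹ᵁ U j) (unitSectionLEₗ (p₁ ≫ g) M (h₂V i j)) :=
    fun i j => isBaseChange_unitSectionLE (p₁ ≫ g) M (h₂V i j) hV (hU₂aff i j) hM
  haveI : Module.FaithfullyFlat Γ(X, V) (Π i, Γ(Z, U i)) := faithfullyFlat_pi_appLE g hV U hUV hUaff hcov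
  have hJ := isBaseChange_pi_algebra (R := Γ(X, V)) (fun i => Γ(Z, U i))
    (fun i => Γ((Scheme.Modules.pullback g).obj M, U i)) (fun i => unitSectionLEₗ g M (hUV i)) hj
  have hJ₂ := isBaseChange_pi_algebra (R := Γ(X, V)) (fun i => Π j, Γ(Z₂, p₁ ⁻¹ᵁ U i ⊓ p₂ ⁻¹ᵁ U j))
    (fun i => Π j, Γ((Scheme.Modules.pullback (p₁ ≫ g)).obj M, p₁ ⁻¹ᵁ U i ⊓ p₂ ⁻¹ᵁ U j))
    (fun i => LinearMap.pi fun j => unitSectionLEₗ (p₁ ≫ g) M (h₂V i j))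
    fun i => isBaseChange_pi_algebra (R := Γ(X, V)) (fun j => Γ(Z₂, p₁ ⁻¹ᵁ U i ⊓ p₂ ⁻¹ᵁ U j))
      (fun j => Γ((Scheme.Modules.pullback (p₁ ≫ g)).obj M, p₁ ⁻¹ᵁ U i ⊓ p₂ ⁻¹ᵁ U j))
      (fun j => unitSectionLEₗ (p₁ ≫ g) M (h₂V i j)) (hj₂ i)
  -- the coprojections `Γ(U_i) → Γ(p₁⁻¹U_i ∩ p₂⁻¹U_j) ← Γ(U_j)` as `Γ(V)`-algebra maps
  have hc₂ : ∀ i j, (p₂ ≫ g).appLE V (p₁ ⁻¹ᵁ U i ⊓ p₂ ⁻¹ᵁ U j)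
      (inf_le_right.trans (p₂.preimage_mono (hUV j)) : p₁ ⁻¹ᵁ U i ⊓ p₂ ⁻¹ᵁ U j ≤ (p₂ ≫ g) ⁻¹ᵁ V) =
      (p₁ ≫ g).appLE V (p₁ ⁻¹ᵁ U i ⊓ p₂ ⁻¹ᵁ U j) (h₂V i j) := fun i j =>
    appLE_congr_of_eq H₂.w.symm V _ _ _
  let φ₁ : ∀ i j, Γ(Z, U i) →ₐ[Γ(X, V)] Γ(Z₂, p₁ ⁻¹ᵁ U i ⊓ p₂ ⁻¹ᵁ U j) := fun i j =>
    { toRingHom := (p₁.appLE (U i) (p₁ ⁻¹ᵁ U i ⊓ p₂ ⁻¹ᵁ U j) inf_le_left).hom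
      commutes' := fun r => by
        change (g.appLE V (U i) (hUV i) ≫ p₁.appLE (U i) (p₁ ⁻¹ᵁ U i ⊓ p₂ ⁻¹ᵁ U j) inf_le_left) r =
          (p₁ ≫ g).appLE V (p₁ ⁻¹ᵁ U i ⊓ p₂ ⁻¹ᵁ U j) (h₂V i j) r
        rw [Scheme.Hom.appLE_comp_appLE] }
  let φ₂ : ∀ i j, Γ(Z, U j) →ₐ[Γ(X, V)] Γ(Z₂, p₁ ⁻¹ᵁ U i ⊓ p₂ ⁻¹ᵁ U j) := fun i j =>
    { toRingHom := (p₂.appLE (U j) (p₁ ⁻¹ᵁ U i ⊓ p₂ ⁻¹ᵁ U j) inf_le_right).hom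
      commutes' := fun r => by
        change (g.appLE V (U j) (hUV j) ≫ p₂.appLE (U j) (p₁ ⁻¹ᵁ U i ⊓ p₂ ⁻¹ᵁ U j) inf_le_right) r =
          (p₁ ≫ g).appLE V (p₁ ⁻¹ᵁ U i ⊓ p₂ ⁻¹ᵁ U j) (h₂V i j) r
        rw [Scheme.Hom.appLE_comp_appLE, ← hc₂ i j] }
  have hφ : ∀ i j, Function.Bijective (Algebra.TensorProduct.lift (φ₁ i j) (φ₂ i j) fun _ _ => Commute.all _ _) :=
    fun i j => bijective_lift_kernelPair_of_le g p₁ p₂ H₂ hV (hUV i) (hUV j) (hUaff i) (hUaff j) (h₂V i j)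
      (φ₁ i j) (φ₂ i j) (fun _ => rfl) (fun _ => rfl)
  have hψ := bijective_lift_pi_pi (R := Γ(X, V)) (fun i => Γ(Z, U i)) (fun i j => Γ(Z₂, p₁ ⁻¹ᵁ U i ⊓ p₂ ⁻¹ᵁ U j))
    φ₁ φ₂ hφ
  -- the two cofaces, piece by piece
  let δ₁ : (Π i, Γ((Scheme.Modules.pullback g).obj M, U i)) →+
      (Π i, Π j, Γ((Scheme.Modules.pullback (p₁ ≫ g)).obj M, p₁ ⁻¹ᵁ U i ⊓ p₂ ⁻¹ᵁ U j)) :=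
    { toFun := fun t i j => ((Scheme.Modules.pullback (p₁ ≫ g)).obj M).presheaf.map
        (homOfLE (inf_le_left : p₁ ⁻¹ᵁ U i ⊓ p₂ ⁻¹ᵁ U j ≤ p₁ ⁻¹ᵁ U i)).op
        (((Scheme.Modules.pullbackComp p₁ g).hom.app M).app (p₁ ⁻¹ᵁ U i)
          (unitSection p₁ ((Scheme.Modules.pullback g).obj M) (U i) (t i)))
      map_zero' := by
        funext i j
        simp only [unitSection, Pi.zero_apply, map_zero]
      map_add' := fun t t' => by
        funext i j
        simp only [Pi.add_apply, unitSection_add, map_add] }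
  let δ₂ : (Π i, Γ((Scheme.Modules.pullback g).obj M, U i)) →+
      (Π i, Π j, Γ((Scheme.Modules.pullback (p₁ ≫ g)).obj M, p₁ ⁻¹ᵁ U i ⊓ p₂ ⁻¹ᵁ U j)) :=
    { toFun := fun t i j => ((Scheme.Modules.pullback (p₁ ≫ g)).obj M).presheaf.map
        (homOfLE (inf_le_right : p₁ ⁻¹ᵁ U i ⊓ p₂ ⁻¹ᵁ U j ≤ p₂ ⁻¹ᵁ U j)).op
        (((Scheme.Modules.pullbackCongr H₂.w.symm).hom.app M).app (p₂ ⁻¹ᵁ U j)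
          (((Scheme.Modules.pullbackComp p₂ g).hom.app M).app (p₂ ⁻¹ᵁ U j)
            (unitSection p₂ ((Scheme.Modules.pullback g).obj M) (U j) (t j))))
      map_zero' := by
        funext i j
        simp only [unitSection, Pi.zero_apply, map_zero]
      map_add' := fun t t' => by
        funext i j
        simp only [Pi.add_apply, unitSection_add, map_add] }
  have hδ₁ : ∀ (c : Π i, Γ(Z, U i)) (t : Π i, Γ((Scheme.Modules.pullback g).obj M, U i)),
      δ₁ (c • t) =
        (AlgHom.pi fun i => AlgHom.pi fun j => (φ₁ i j).comp (Pi.evalAlgHom Γ(X, V) (fun i => Γ(Z, U i)) i)) c • δ₁ t := by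
    intro c t
    funext i j
    exact cofaceFst_smul_of_le g p₁ p₂ M (U i) (U j) (c i) (t i)
  have hδ₂ : ∀ (c : Π i, Γ(Z, U i)) (t : Π i, Γ((Scheme.Modules.pullback g).obj M, U i)),
      δ₂ (c • t) =
        (AlgHom.pi fun i => AlgHom.pi fun j => (φ₂ i j).comp (Pi.evalAlgHom Γ(X, V) (fun i => Γ(Z, U i)) j)) c • δ₂ t := by
    intro c t
    funext i j
    exact cofaceSnd_smul_of_le g p₁ p₂ M H₂.w.symm (U i) (U j) (c j) (t j)
  have hδ₁j : ∀ m : Γ(M, V), δ₁ (LinearMap.pi (fun i => unitSectionLEₗ g M (hUV i)) m) =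
      LinearMap.pi (fun i => LinearMap.pi fun j => unitSectionLEₗ (p₁ ≫ g) M (h₂V i j)) m := by
    intro m
    funext i j
    exact cofaceFst_unitSectionLE g p₁ p₂ M (hUV i) (hUV j) (h₂V i j) m
  have hδ₂j : ∀ m : Γ(M, V), δ₂ (LinearMap.pi (fun i => unitSectionLEₗ g M (hUV i)) m) =
      LinearMap.pi (fun i => LinearMap.pi fun j => unitSectionLEₗ (p₁ ≫ g) M (h₂V i j)) m := by
    intro m
    funext i j
    exact cofaceSnd_unitSectionLE g p₁ p₂ M H₂.w.symm (hUV i) (hUV j) (h₂V i j) m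
  -- the datum: `s` restricted to the pieces, and its cocycle condition piece by piece
  have hx : δ₁ (fun i => ((Scheme.Modules.pullback g).obj M).presheaf.map (homOfLE (hUV i)).op s) =
      δ₂ (fun i => ((Scheme.Modules.pullback g).obj M).presheaf.map (homOfLE (hUV i)).op s) := by
    funext i j
    change ((Scheme.Modules.pullback (p₁ ≫ g)).obj M).presheaf.map _ (((Scheme.Modules.pullbackComp p₁ g).hom.app M).app _
        (unitSection p₁ _ (U i) (((Scheme.Modules.pullback g).obj M).presheaf.map (homOfLE (hUV i)).op s))) =
      ((Scheme.Modules.pullback (p₁ ≫ g)).obj M).presheaf.map _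
        (((Scheme.Modules.pullbackCongr H₂.w.symm).hom.app M).app _ (((Scheme.Modules.pullbackComp p₂ g).hom.app M).app _
        (unitSection p₂ _ (U j) (((Scheme.Modules.pullback g).obj M).presheaf.map (homOfLE (hUV j)).op s))))
    rw [cofaceFst_map_of_le g p₁ p₂ M (hUV i) (hUV j) s, cofaceSnd_map_of_le g p₁ p₂ M H₂.w.symm (hUV i) (hUV j) s, hs]
  -- Amitsur
  obtain ⟨m, hm, -⟩ := existsUnique_of_isBaseChange
    (AlgHom.pi fun i => AlgHom.pi fun j => (φ₁ i j).comp (Pi.evalAlgHom Γ(X, V) (fun i => Γ(Z, U i)) i))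
    (AlgHom.pi fun i => AlgHom.pi fun j => (φ₂ i j).comp (Pi.evalAlgHom Γ(X, V) (fun i => Γ(Z, U i)) j))
    (LinearMap.pi fun i => unitSectionLEₗ g M (hUV i))
    (LinearMap.pi fun i => LinearMap.pi fun j => unitSectionLEₗ (p₁ ≫ g) M (h₂V i j))
    δ₁ δ₂ hJ hJ₂ hψ hδ₁ hδ₂ hδ₁j hδ₂j _ hx
  -- `η(m)|_{U_i} = s|_{U_i}` for all `i`, hence `η(m) = s`
  have hmi : ∀ i, ((Scheme.Modules.pullback g).obj M).presheaf.map (homOfLE (hUV i)).op (unitSection g M V m) =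
      ((Scheme.Modules.pullback g).obj M).presheaf.map (homOfLE (hUV i)).op s := fun i => by
    have h := congrFun hm i
    simp only [LinearMap.pi_apply, unitSectionLEₗ_apply, unitSectionLE] at h
    exact h
  have hms : unitSection g M V m = s :=
    TopCat.Sheaf.eq_of_locally_eq'
      (⟨((Scheme.Modules.pullback g).obj M).presheaf, ((Scheme.Modules.pullback g).obj M).isSheaf⟩ : TopCat.Sheaf Ab Z)
      U (g ⁻¹ᵁ V) (fun i => homOfLE (hUV i)) hcov _ _ hmi
  exact ⟨m, hms, fun m' hm' => unitSection_injective_of_affine_of_iSup g M hV U hUV hUaff hcov (hm'.trans hms.symm)⟩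

/-- **A finite affine cover of `g⁻¹V`** for `g` quasi-compact and `V` affine (`g⁻¹V` is a quasi-compact open, Mathlib
`isCompact_iff_finite_and_eq_biUnion_affineOpens`). [cite: StacksProject, Tag 023M] -/
theorem exists_finite_affineOpens_cover_preimage [QuasiCompact g] (hV : IsAffineOpen V) :
    ∃ t : Set Z.affineOpens, t.Finite ∧ (∀ i ∈ t, (i : Z.Opens) ≤ g ⁻¹ᵁ V) ∧
      g ⁻¹ᵁ V ≤ ⨆ i : t, ((i : Z.affineOpens) : Z.Opens) := by
  have hc : IsCompact (g ⁻¹ᵁ V : Set Z) := QuasiCompact.isCompact_preimage (f := g) _ V.isOpen hV.isCompact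
  obtain ⟨t, ht, he⟩ := isCompact_iff_finite_and_eq_biUnion_affineOpens.mp hc
  refine ⟨t, ht, fun i hi => ?_, ?_⟩
  · rw [he]
    exact le_iSup₂ (f := fun (i : Z.affineOpens) (_ : i ∈ t) => (i : Z.Opens)) i hi
  · rw [he, iSup_subtype']

/-- **`η` is injective on an affine chart, `g` quasi-compact** (`unitSection_injective_of_affine_of_iSup` on a finite affine
cover of `g⁻¹V`). [cite: StacksProject, Tag 023M] [cite: GortzWedhorn2020, Prop. 14.66] -/
theorem unitSection_injective_of_affine_of_quasiCompact [QuasiCompact g] [Flat g] [Surjective g] [M.IsQuasicoherent]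
    (hV : IsAffineOpen V) : Function.Injective (unitSection g M V) := by
  obtain ⟨t, ht, htV, hcov⟩ := exists_finite_affineOpens_cover_preimage g hV
  haveI : Finite t := ht.to_subtype
  exact unitSection_injective_of_affine_of_iSup g M hV (fun i : t => ((i : Z.affineOpens) : Z.Opens))
    (fun i => htV i.1 i.2) (fun i => i.1.2) hcov

/-- **Descent of sections on an affine chart, `g` quasi-compact** (`existsUnique_unitSection_eq_of_affine_of_iSup` on a finite
affine cover of `g⁻¹V`). [cite: SGA1, Exp. VIII Thm. 1.1 and Cor. 1.2] [cite: StacksProject, Tag 023M] [cite: GortzWedhorn2020, Prop. 14.66] -/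
theorem existsUnique_unitSection_eq_of_affine_of_quasiCompact [QuasiCompact g] [Flat g] [Surjective g] [M.IsQuasicoherent]
    (H₂ : IsPullback p₁ p₂ g g) (hV : IsAffineOpen V) (s : Γ((Scheme.Modules.pullback g).obj M, g ⁻¹ᵁ V))
    (hs : ((Scheme.Modules.pullback (p₁ ≫ g)).obj M).presheaf.map
        (homOfLE (inf_le_left : p₁ ⁻¹ᵁ (g ⁻¹ᵁ V) ⊓ p₂ ⁻¹ᵁ (g ⁻¹ᵁ V) ≤ p₁ ⁻¹ᵁ (g ⁻¹ᵁ V))).op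
        (((Scheme.Modules.pullbackComp p₁ g).hom.app M).app (p₁ ⁻¹ᵁ (g ⁻¹ᵁ V))
          (unitSection p₁ ((Scheme.Modules.pullback g).obj M) (g ⁻¹ᵁ V) s)) =
      ((Scheme.Modules.pullback (p₁ ≫ g)).obj M).presheaf.map
        (homOfLE (inf_le_right : p₁ ⁻¹ᵁ (g ⁻¹ᵁ V) ⊓ p₂ ⁻¹ᵁ (g ⁻¹ᵁ V) ≤ p₂ ⁻¹ᵁ (g ⁻¹ᵁ V))).op
        (((Scheme.Modules.pullbackCongr H₂.w.symm).hom.app M).app (p₂ ⁻¹ᵁ (g ⁻¹ᵁ V))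
          (((Scheme.Modules.pullbackComp p₂ g).hom.app M).app (p₂ ⁻¹ᵁ (g ⁻¹ᵁ V))
            (unitSection p₂ ((Scheme.Modules.pullback g).obj M) (g ⁻¹ᵁ V) s)))) :
    ∃! m : Γ(M, V), unitSection g M V m = s := by
  obtain ⟨t, ht, htV, hcov⟩ := exists_finite_affineOpens_cover_preimage g hV
  haveI : Finite t := ht.to_subtype
  exact existsUnique_unitSection_eq_of_affine_of_iSup g p₁ p₂ M H₂ hV (fun i : t => ((i : Z.affineOpens) : Z.Opens))
    (fun i => htV i.1 i.2) (fun i => i.1.2) hcov s hs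

end Chart

/-! ### §2 Gluing over the affine opens of `X` -/

section Global

variable (V : X.Opens)

/-- **`η : Γ(V, M) → Γ(g⁻¹V, g^*M)` is injective** for `g` quasi-compact, flat and surjective, `M` quasi-coherent and ANY open
`V ⊆ X` (injective on the affine opens below `V`; sheaf locality on `M` — ★ `unitSection_injective` is the case `g` affine).
[cite: SGA1, Exp. VIII Thm. 1.1] [cite: StacksProject, Tag 023M] -/
theorem unitSection_injective_of_quasiCompact [QuasiCompact g] [Flat g] [Surjective g] [M.IsQuasicoherent] :
    Function.Injective (unitSection g M V) := by
  intro m m' h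
  refine TopCat.Sheaf.eq_of_locally_eq' (⟨M.presheaf, M.isSheaf⟩ : TopCat.Sheaf Ab X)
    (fun W : {W : X.affineOpens // (W : X.Opens) ≤ V} => (W.1 : X.Opens)) V (fun W => homOfLE W.2)
    (le_iSup_affineOpens_le V) m m' fun W => ?_
  change M.presheaf.map (homOfLE W.2).op m = M.presheaf.map (homOfLE W.2).op m'
  apply unitSection_injective_of_affine_of_quasiCompact g M W.1.2
  rw [unitSection_map, unitSection_map, h]

/-- **Sections of a quasi-coherent module form an fpqc sheaf (equaliser exactness in the middle)** for `g : Z → X`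
QUASI-COMPACT, flat and surjective, `p₁, p₂ : Z₂ ⇉ Z` a kernel pair (`IsPullback p₁ p₂ g g`), `M` quasi-coherent and ANY open
`V ⊆ X`: a section `s ∈ Γ(g⁻¹V, g^*M)` whose two cofaces on `U₂ = p₁⁻¹g⁻¹V ∩ p₂⁻¹g⁻¹V` agree is `η(m)` for a UNIQUE
`m ∈ Γ(V, M)` (the chart statement `existsUnique_unitSection_eq_of_affine_of_quasiCompact` on the affine opens below `V`, the
cofaces commute with restriction — ★ `cofaceFst_map`/`cofaceSnd_map` —, the local solutions glue in the sheaf `M` and map to `s`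
by locality in `g^*M`; ★ `existsUnique_unitSection_eq` is the case `g` affine).
[cite: SGA1, Exp. VIII Thm. 1.1, Cor. 1.2] [cite: StacksProject, Tag 023M] [cite: GortzWedhorn2020, Prop. 14.66] -/
theorem existsUnique_unitSection_eq_of_quasiCompact [QuasiCompact g] [Flat g] [Surjective g] [M.IsQuasicoherent]
    (H₂ : IsPullback p₁ p₂ g g) (s : Γ((Scheme.Modules.pullback g).obj M, g ⁻¹ᵁ V))
    (hs : ((Scheme.Modules.pullback (p₁ ≫ g)).obj M).presheaf.map
        (homOfLE (inf_le_left : p₁ ⁻¹ᵁ (g ⁻¹ᵁ V) ⊓ p₂ ⁻¹ᵁ (g ⁻¹ᵁ V) ≤ p₁ ⁻¹ᵁ (g ⁻¹ᵁ V))).op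
        (((Scheme.Modules.pullbackComp p₁ g).hom.app M).app (p₁ ⁻¹ᵁ (g ⁻¹ᵁ V))
          (unitSection p₁ ((Scheme.Modules.pullback g).obj M) (g ⁻¹ᵁ V) s)) =
      ((Scheme.Modules.pullback (p₁ ≫ g)).obj M).presheaf.map
        (homOfLE (inf_le_right : p₁ ⁻¹ᵁ (g ⁻¹ᵁ V) ⊓ p₂ ⁻¹ᵁ (g ⁻¹ᵁ V) ≤ p₂ ⁻¹ᵁ (g ⁻¹ᵁ V))).op
        (((Scheme.Modules.pullbackCongr H₂.w.symm).hom.app M).app (p₂ ⁻¹ᵁ (g ⁻¹ᵁ V))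
          (((Scheme.Modules.pullbackComp p₂ g).hom.app M).app (p₂ ⁻¹ᵁ (g ⁻¹ᵁ V))
            (unitSection p₂ ((Scheme.Modules.pullback g).obj M) (g ⁻¹ᵁ V) s)))) :
    ∃! m : Γ(M, V), unitSection g M V m = s := by
  -- local solutions on the affine opens below `V`
  have hloc : ∀ i : {W : X.affineOpens // (W : X.Opens) ≤ V}, ∃ m : Γ(M, (i.1 : X.Opens)),
      unitSection g M i.1 m = ((Scheme.Modules.pullback g).obj M).presheaf.map (homOfLE (g.preimage_mono i.2)).op s := fun i =>
    (existsUnique_unitSection_eq_of_affine_of_quasiCompact g p₁ p₂ M H₂ i.1.2 _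
      (by rw [cofaceFst_map g p₁ p₂ M i.2 s, cofaceSnd_map g p₁ p₂ M H₂.w.symm i.2 s, hs])).exists
  choose mloc hmloc using hloc
  -- they agree on overlaps (`η` is injective over `Wᵢ ∩ Wⱼ`)
  have hcompat : ∀ i j : {W : X.affineOpens // (W : X.Opens) ≤ V},
      M.presheaf.map (homOfLE (inf_le_left : (i.1 : X.Opens) ⊓ j.1 ≤ i.1)).op (mloc i) =
        M.presheaf.map (homOfLE (inf_le_right : (i.1 : X.Opens) ⊓ j.1 ≤ j.1)).op (mloc j) := by
    intro i j
    apply unitSection_injective_of_quasiCompact g M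
    rw [unitSection_map, unitSection_map, hmloc, hmloc, ← CategoryTheory.comp_apply, ← Functor.map_comp,
      ← CategoryTheory.comp_apply, ← Functor.map_comp]
    exact presheaf_map_congr _ _ _ _
  -- glue in `M`
  obtain ⟨m, hm, -⟩ := TopCat.Sheaf.existsUnique_gluing' (⟨M.presheaf, M.isSheaf⟩ : TopCat.Sheaf Ab X)
    (fun W : {W : X.affineOpens // (W : X.Opens) ≤ V} => (W.1 : X.Opens)) V (fun W => homOfLE W.2)
    (le_iSup_affineOpens_le V) mloc hcompat
  have hm' : ∀ i : {W : X.affineOpens // (W : X.Opens) ≤ V}, M.presheaf.map (homOfLE i.2).op m = mloc i := hm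
  -- `η(m) = s`, by locality in `g^*M` along the cover `g⁻¹Wᵢ` of `g⁻¹V`
  have hms : unitSection g M V m = s := by
    refine TopCat.Sheaf.eq_of_locally_eq'
      (⟨((Scheme.Modules.pullback g).obj M).presheaf, ((Scheme.Modules.pullback g).obj M).isSheaf⟩ : TopCat.Sheaf Ab Z)
      (fun W : {W : X.affineOpens // (W : X.Opens) ≤ V} => g ⁻¹ᵁ (W.1 : X.Opens)) (g ⁻¹ᵁ V)
      (fun W => homOfLE (g.preimage_mono W.2)) ?_ _ _ fun i => ?_
    · rw [← Scheme.Hom.preimage_iSup]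
      exact g.preimage_mono (le_iSup_affineOpens_le V)
    · change ((Scheme.Modules.pullback g).obj M).presheaf.map (homOfLE (g.preimage_mono i.2)).op (unitSection g M V m) =
        ((Scheme.Modules.pullback g).obj M).presheaf.map (homOfLE (g.preimage_mono i.2)).op s
      rw [← hmloc i, ← hm' i, unitSection_map]
      exact presheaf_map_congr _ _ _ _
  exact ⟨m, hms, fun m' hm'' => unitSection_injective_of_quasiCompact g M V (hm''.trans hms.symm)⟩

/-- **`Γ(V, M) = eq(Γ(g⁻¹V, g^*M) ⇉ Γ(U₂, (p₁ ≫ g)^*M))` as a range statement, `g` quasi-compact**: a section of `g^*M` over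
`g⁻¹V` is pulled back from `V` iff its two cofaces agree (★ `cofaceFst_unitSection`/`cofaceSnd_unitSection` and
`existsUnique_unitSection_eq_of_quasiCompact`); with `unitSection_injective_of_quasiCompact` this is the exactness of
`0 → Γ(V, M) → Γ(g⁻¹V, g^*M) ⇉ Γ(U₂, (p₁ ≫ g)^*M)`. [cite: SGA1, Exp. VIII Thm. 1.1, Cor. 1.2] [cite: StacksProject, Tag 023M]
[cite: GortzWedhorn2020, Prop. 14.66] -/
theorem mem_range_unitSection_iff_of_quasiCompact [QuasiCompact g] [Flat g] [Surjective g] [M.IsQuasicoherent]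
    (H₂ : IsPullback p₁ p₂ g g) (s : Γ((Scheme.Modules.pullback g).obj M, g ⁻¹ᵁ V)) :
    s ∈ Set.range (unitSection g M V) ↔
      ((Scheme.Modules.pullback (p₁ ≫ g)).obj M).presheaf.map
        (homOfLE (inf_le_left : p₁ ⁻¹ᵁ (g ⁻¹ᵁ V) ⊓ p₂ ⁻¹ᵁ (g ⁻¹ᵁ V) ≤ p₁ ⁻¹ᵁ (g ⁻¹ᵁ V))).op
        (((Scheme.Modules.pullbackComp p₁ g).hom.app M).app (p₁ ⁻¹ᵁ (g ⁻¹ᵁ V))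
          (unitSection p₁ ((Scheme.Modules.pullback g).obj M) (g ⁻¹ᵁ V) s)) =
      ((Scheme.Modules.pullback (p₁ ≫ g)).obj M).presheaf.map
        (homOfLE (inf_le_right : p₁ ⁻¹ᵁ (g ⁻¹ᵁ V) ⊓ p₂ ⁻¹ᵁ (g ⁻¹ᵁ V) ≤ p₂ ⁻¹ᵁ (g ⁻¹ᵁ V))).op
        (((Scheme.Modules.pullbackCongr H₂.w.symm).hom.app M).app (p₂ ⁻¹ᵁ (g ⁻¹ᵁ V))
          (((Scheme.Modules.pullbackComp p₂ g).hom.app M).app (p₂ ⁻¹ᵁ (g ⁻¹ᵁ V))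
            (unitSection p₂ ((Scheme.Modules.pullback g).obj M) (g ⁻¹ᵁ V) s))) := by
  constructor
  · rintro ⟨m, rfl⟩
    rw [cofaceFst_unitSection, cofaceSnd_unitSection]
  · intro hs
    obtain ⟨m, hm, -⟩ := existsUnique_unitSection_eq_of_quasiCompact g p₁ p₂ M V H₂ s hs
    exact ⟨m, hm⟩

end Global

end Literature.AlgebraicGeometry.Morphisms

end
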